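import Literature.MathematicalPhysics.QuantumFieldTheory.Balaban1983to89.B9Eq3119DeltaPiTowerReality
import Literature.MathematicalPhysics.QuantumFieldTheory.Balaban1983to89.B9Eq3117DivHessOpGaugeMode
import Literature.MathematicalPhysics.QuantumFieldTheory.Balaban1983to89.B9Eq3119DeltaPiCarrier

/-!
# `Balaban1983to89.B11Eq88LaplaceH1CurrentSymmetry` — T. Bałaban, *The variational problem and background fields in renormalization group method for lattice
# gauge theories*, Commun. Math. Phys. **102** (1985) 277–309 [Balaban1985Variational] (27) p. 282, (80) p. 290, (87)–(88) p. 291; *Propagators for lattice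
# gauge theories in a background field*, Commun. Math. Phys. **99** (1985) 389–434 [Balaban1985BackgroundPropagators] (3.8)–(3.11) p. 392 («For U with values
# in the unitary group U(N) it is a hermitian operator»), (3.21) p. 394, (3.119) p. 419, (3.122) p. 420: **THE (27)-SYMMETRY BINDER `hsym` OF THE RE-TYPED
# PROPOSITION 4 (`B11Eq98W80Composite.quadAnalytic_W80_composite`) AT THE CHAIN's LETTERS — print's second-order operator `π_k†Δ^ηπ_k + D_U R_k D*_U =
# Δ̃_{a,k} − Q_k†aQ_k` of (87)–(88) is symmetric for the BILINEAR trace pairing (3.11) at a unitary tower, hence its current reading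
# `currentCLM φ lev₁ Dc (Δ̃_{a,k} − Q_k†aQ_k)` satisfies `Σ_b τ((ΔY₁)(b)·Y₂(b)) = Σ_b τ((ΔY₂)(b)·Y₁(b))`**

statement-level skeleton of published theorems with citation tags; proofs where landed; nothing here is a claim about the Yang–Mills mass gap

CITATION HEADER (lean-in-tree rule).  Audit cell `pub-balaban`, sub-cell `t4`, BINDER row NE9; NE9 crux-team LEAF PROVER 01 (`b2b-balaban-t4-ne9-formalise-leaf-01`,
gen 98; bears_on: R4/N22), step (E′)(3a) of the lineage memo `LOCATED-after-g97.md` §2.  Composition BY NAME of: `B9Eq311TracePairing` (`tpair`, `starW`,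
`tpair_eq_inner_starW`), `B9Eq3117DivHessOpGaugeMode.tpair_covDerivL2K` ((3.8) for the trace pairing), `B9Eq326OperatorTower.RofUk_isSymmetric` +
`B9Eq326OperatorTowerReality.RofUk_starW` ((3.21) symmetric and real), `B9Eq3119DeltaPiTower.tpair_deltaPiOfUk_comm` + `B9Eq3119DeltaPiTowerReality.
deltaPiOfUk_GpOfUk_eq_adjoint_form` ((3.119): `π_kᵗΔ^ηπ_k = π_k†Δ^ηπ_k` at a unitary tower), `B9Eq3119DeltaPiCarrier.pairSum_currentCLM_comm` (the carrier
reading).  Sources read through the audited headers of those files (`paper:balaban1985-cmp99-background-propagators` pp. 392, 394, 419–420;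
`paper:balaban1985-cmp102-variational-background` pp. 282, 290–291).  Nothing of print's proofs reproduced; no constant of print valued.

WHAT IS PROVED (sorry-free; proof lane — no `def`; [folklore] `*`-algebra bookkeeping BY NAME).
* §1 `tpair_comm_of_isSymmetric_of_starW` — a Hilbert-symmetric operator commuting with the fibre involution is symmetric for the bilinear trace pairing.
* §2 `tpair_RofUk_comm` (`R_k(U)`), **`tpair_DRD_comm`** (`D_U R_k(U) D*_U`), **`laplaceAkPi_sub_QaQ_apply`** (`(Δ̃_{a,k} − Q_k†aQ_k)x = (π_k†Δ^ηπ_k)x + D_U(R_k(D*_Ux))`,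
  definitional bookkeeping of (3.122)), **`tpair_laplaceAkPi_sub_QaQ_comm`** — `Δ̃_{a,k} − Q_k†aQ_k` IS SYMMETRIC FOR THE BILINEAR TRACE PAIRING at a unitary
  tower (`U(b)⋆ = U(b)⁻¹`, `Ū^j(b)⋆ = Ū^j(b)⁻¹`), a `⋆`-tracial `τ` and the cell's norming `⟪φ⁻¹X, φ⁻¹Y⟫ = τ(X⋆Y)`.
* §3 **`pairSum_current_laplaceAkPi_sub_QaQ_comm`** — THE BINDER `hsym` OF `B11Eq98W80Composite.quadAnalytic_W80_composite` VERBATIM for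
  `Δπ := currentCLM φ lev₁ Dc (Δ̃_{a,k} − Q_k†∘(aQ_k))` and the trace read as a continuous functional `LinearMap.toContinuousLinearMap τ`:
  `∀ Y₁ Y₂, Σ_b τ((Δπ Y₁)(b)·Y₂(b)) = Σ_b τ((Δπ Y₂)(b)·Y₁(b))` (the `η^d` of `pairSum_currentCLM_comm` cancelled, `η > 0`).
HONEST SCOPE.  Identities at the unitary centre only; NO estimate; the positivity `hpos′` of `Δ′_{a′,k}(U)` DISPLAYED (it constructs `G′_k`); NOT the θ_E′
letter, NOT the lattice-free Prop. 4 (sequel files of this generation); NE9 NOT PRINTED ∕ NOT PROVED; «NE9 ⇐ the named binders»; row WALLED ON A MODEL (O-NE9-1; #5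
UNRULED); spine PROVED 0∕9; rung (B)+1 on a finite T⁴ — NOT infinite volume, NOT mass gap, NOT BetaPertH, NOT Clay.  HONEST DEPENDENCY: continuum YM on T⁴ ⇐
BetaPertH ∧ nine spine estimates (0/9 proved); BetaPertH ⇐ (D1) ∧ (D4) ∧ CAP+tail; G-an2-4 gates asym, D1 and NE2/3/4.  NEW file; nothing modified.
Net new unproved facts: 0.
-/

noncomputable section

set_option autoImplicit false

open scoped InnerProductSpace ComplexConjugate BigOperators

namespace Literature.MathematicalPhysics.QuantumFieldTheory.Balaban1983to89.B11Eq88LaplaceH1CurrentSymmetry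

open B4Sect5Torus (TSite)
open B9SectCLatticeCarrier (Bond)
open B9Eq311L2Pairing (WL2)
open B9Eq311TracePairing (starW tpair tpair_comm tpair_add_right tpair_eq_inner_starW)
open B11Eq103H1Complex (SiteL2K BondL2K covDerivL2K covDivL2K laplaceALatticeK laplaceAK laplaceAK_apply)
open B9Eq310HessianOperator (adTransportW hessOp)
open B9Eq315QTower (towerP UlevOf)
open B9Eq315QTorus (perCfg cornerSite)
open B7Prop1Explicit (U1 Wcx boxVec)
open B9Eq326OperatorTower (QkW RofUk RofUk_isSymmetric)
open B9Eq324DeltaPrimeATower (laplacePrimeAk GpOfUk)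
open B9Eq3119DeltaPiTower (piOfUk deltaPiOfUk laplaceAkPi tpair_deltaPiOfUk_comm)
open B9Eq3119DeltaPiTowerReality (deltaPiOfUk_GpOfUk_eq_adjoint_form)
open B9Eq326OperatorTowerReality (RofUk_starW)
open B9Eq3117DivHessOpGaugeMode (tpair_covDerivL2K)
open B9Eq3119DeltaPiCarrier (currentCLM pairSum_currentCLM_comm)
open B11Eq115Space
open B11Eq90V0primeCurrent (flat115)

/-! ## §1 A symmetric real operator is symmetric for the bilinear trace pairing -/

section General

variable {𝔸 : Type*} [Ring 𝔸] [StarRing 𝔸] [Algebra ℂ 𝔸] [StarModule ℂ 𝔸]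
  {W : Type*} [NormedAddCommGroup W] [InnerProductSpace ℂ W] (φ : W ≃ₗ[ℂ] 𝔸) (τ : 𝔸 →ₗ[ℂ] ℂ)
  {ι : Type*} [Fintype ι] {w : ι → ℝ} [Fact (∀ i, 0 < w i)]

omit [StarModule ℂ 𝔸] in
/-- **A Hilbert-symmetric operator commuting with the fibre involution `⋆` is symmetric for the BILINEAR trace pairing (3.11)**: `(x, Ty) = ⟪x⋆, Ty⟫ =
⟪Tx⋆, y⟫ = ⟪(Tx)⋆, y⟫ = (Tx, y) = (y, Tx)` (tracial `τ`, the cell's norming). [cite: Balaban1985BackgroundPropagators, (3.9)–(3.11) p.392] -/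
theorem tpair_comm_of_isSymmetric_of_starW (hτ₂ : ∀ X Y : 𝔸, τ (X * Y) = τ (Y * X))
    (hφ : ∀ X Y : 𝔸, ⟪φ.symm X, φ.symm Y⟫_ℂ = τ (star X * Y)) {T : WL2 ℂ w W →ₗ[ℂ] WL2 ℂ w W} (hT : T.IsSymmetric)
    (hTr : ∀ f, T (starW φ f) = starW φ (T f)) (x y : WL2 ℂ w W) : tpair φ τ x (T y) = tpair φ τ y (T x) := by
  rw [tpair_eq_inner_starW φ τ hφ, ← hT, hTr, ← tpair_eq_inner_starW φ τ hφ, tpair_comm φ τ hτ₂]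

end General

/-! ## §2 `Δ̃_{a,k}(U) − Q_k†aQ_k = π_k†Δ^η(U)π_k + D_U R_k(U) D*_U` is symmetric for the bilinear trace pairing at a unitary tower -/

section Tower

variable {d : ℕ} (L : ℕ) [NeZero L] (m : Fin d → ℕ) [∀ i, NeZero (m i)] (n : ℕ)
  {𝔸 : Type*} [NormedRing 𝔸] [NormedAlgebra ℂ 𝔸] [CompleteSpace 𝔸] [NormOneClass 𝔸] [StarRing 𝔸] [StarModule ℂ 𝔸]
  {W : Type*} [NormedAddCommGroup W] [InnerProductSpace ℂ W] [FiniteDimensional ℂ W] (φ : W ≃ₗ[ℂ] 𝔸) {c₀ : ℝ} [Fact (0 < c₀)]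
  (τ : 𝔸 →ₗ[ℂ] ℂ) (η : ℝ) {U : Bond d (towerP L m (n + 1)) → 𝔸ˣ}
  (hUlev : ∀ (j : ℕ) (b : Bond d (towerP L m (j + 1))), star (UlevOf L m (n + 1) U j b : 𝔸) = ((UlevOf L m (n + 1) U j b)⁻¹ : 𝔸ˣ))
  (hU : ∀ b, star (U b : 𝔸) = ((U b)⁻¹ : 𝔸ˣ))
  (hφ : ∀ X Y : 𝔸, ⟪φ.symm X, φ.symm Y⟫_ℂ = τ (star X * Y)) (hτ₁ : ∀ X : 𝔸, τ (star X) = conj (τ X)) (hτ₂ : ∀ X Y : 𝔸, τ (X * Y) = τ (Y * X))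

include hUlev hU hφ hτ₁ hτ₂ in
omit [NormOneClass 𝔸] in
/-- **`R_k(U)` is symmetric for the bilinear trace pairing on site functions** — symmetric (3.21) and real at a unitary tower.
[cite: Balaban1985BackgroundPropagators, (3.21) p.394, (3.11) p.392] -/
theorem tpair_RofUk_comm (s t : SiteL2K ℂ d (towerP L m (n + 1)) c₀ W) :
    tpair φ τ s (RofUk L m n φ η U t) = tpair φ τ t (RofUk L m n φ η U s) :=
  tpair_comm_of_isSymmetric_of_starW φ τ hτ₂ hφ (RofUk_isSymmetric L m n φ η U) (RofUk_starW L φ m n η hUlev hU τ hφ hτ₁ hτ₂) s t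

include hUlev hU hφ hτ₁ hτ₂ in
omit [NormOneClass 𝔸] in
/-- **`D_U R_k(U) D*_U` is symmetric for the bilinear trace pairing**: `(x, D R D* y) = (D*x, R D* y) = (D*y, R D* x) = (y, D R D* x)` — (3.8) for the trace
pairing and §2's `tpair_RofUk_comm`. [cite: Balaban1985BackgroundPropagators, (3.8) p.392, (3.21) p.394; Balaban1985Variational, (87) p.291] -/
theorem tpair_DRD_comm (x y : BondL2K ℂ d (towerP L m (n + 1)) c₀ W) :
    tpair φ τ x (covDerivL2K ℂ c₀ ((η : ℂ))⁻¹ (adTransportW φ U)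
        (RofUk L m n φ η U (covDivL2K ℂ c₀ ((η : ℂ))⁻¹ (adTransportW φ fun b => (U b)⁻¹) y))) =
      tpair φ τ y (covDerivL2K ℂ c₀ ((η : ℂ))⁻¹ (adTransportW φ U)
        (RofUk L m n φ η U (covDivL2K ℂ c₀ ((η : ℂ))⁻¹ (adTransportW φ fun b => (U b)⁻¹) x))) := by
  rw [tpair_covDerivL2K φ τ hτ₂ hφ η hU, tpair_covDerivL2K φ τ hτ₂ hφ η hU, tpair_RofUk_comm L m n φ τ η hUlev hU hφ hτ₁ hτ₂]

variable {c₁ : ℝ} [Fact (0 < c₁)] (a' : ℝ)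
  (hpos' : ∀ x : SiteL2K ℂ d (towerP L m (n + 1)) c₀ W, x ≠ 0 → 0 < RCLike.re ⟪x, laplacePrimeAk L m n φ η U a' (c₁ := c₁) x⟫_ℂ)
  (hL : 1 ≤ L) (αU : ℕ → ℝ) (hα1 : ∀ j, αU j ≤ 1 / 64)
  (hU1 : ∀ (j : ℕ) (x : B7Prop1Explicit.Site d) (κ : Fin d), perCfg (towerP L m (j + 1)) (UlevOf L m (n + 1) U j) x κ ∈ U1 𝔸)
  (hreg : ∀ (j : ℕ) (y : TSite d (towerP L m j)) (κ : Fin d) (r : Fin d → Fin L),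
    ‖((Wcx L (perCfg (towerP L m (j + 1)) (UlevOf L m (n + 1) U j)) (cornerSite L y) κ (boxVec L r) : 𝔸ˣ) : 𝔸) - 1‖ ≤ αU j)

/-- **`(Δ̃_{a,k} − Q_k†∘(aQ_k))x = (π_k†∘Δ^η(U)∘π_k)x + D_U(R_k(U)(D*_Ux))`** — print's (87) operator `Δ_π + DRD*` is the second-order part of (3.122)
`Δ̃_{a,k} = π†Δ^ηπ + DR_kD* + Q_k†aQ_k` (definitional bookkeeping: `laplaceALatticeK` ∕ `laplaceAK`). [cite: Balaban1985BackgroundPropagators, (3.122) p.420; Balaban1985Variational, (87) p.291] -/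
theorem laplaceAkPi_sub_QaQ_apply (a : ℝ) (x : BondL2K ℂ d (towerP L m (n + 1)) c₀ W) :
    (laplaceAkPi L m n φ τ η U a' hpos' hL αU hα1 hU1 hreg (c₁ := c₁) a
        - LinearMap.adjoint (QkW L m n φ U hL αU hα1 hU1 hreg (c₀ := c₀) (c₁ := c₁)) ∘ₗ
            ((a : ℂ) • QkW L m n φ U hL αU hα1 hU1 hreg (c₀ := c₀) (c₁ := c₁))) x =
      (LinearMap.adjoint (piOfUk L m n φ η U (GpOfUk L m n φ η U a' hpos')) ∘ₗ hessOp φ η U τ ∘ₗ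
          piOfUk L m n φ η U (GpOfUk L m n φ η U a' hpos')) x +
        covDerivL2K ℂ c₀ ((η : ℂ))⁻¹ (adTransportW φ U)
          (RofUk L m n φ η U (covDivL2K ℂ c₀ ((η : ℂ))⁻¹ (adTransportW φ fun b => (U b)⁻¹) x)) := by
  -- the two `Q_k†aQ_k` terms agree up to the (defeq) casts `ℝ → ℂ` of `laplaceALatticeK` and of the statement
  rw [LinearMap.sub_apply]
  refine sub_eq_of_eq_add ?_
  rfl

include hUlev hU hφ hτ₁ hτ₂ in
/-- **`Δ̃_{a,k}(U) − Q_k†aQ_k = π_k†Δ^ηπ_k + D_U R_k D*_U` IS SYMMETRIC FOR THE BILINEAR TRACE PAIRING** at a unitary tower with a `⋆`-tracial `τ`: the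
`π_k†Δ^ηπ_k` part is the bilinear `Δ_{π,k}(U) = π_kᵗΔ^ηπ_k` there (`deltaPiOfUk_GpOfUk_eq_adjoint_form`), symmetric by (3.119) (`tpair_deltaPiOfUk_comm`); the
`DR_kD*` part by `tpair_DRD_comm`. [cite: Balaban1985BackgroundPropagators, (3.119) p.419, (3.122) p.420, p.392; Balaban1985Variational, (87)–(88) p.291] -/
theorem tpair_laplaceAkPi_sub_QaQ_comm (a : ℝ) (x y : BondL2K ℂ d (towerP L m (n + 1)) c₀ W) :
    tpair φ τ x ((laplaceAkPi L m n φ τ η U a' hpos' hL αU hα1 hU1 hreg (c₁ := c₁) a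
        - LinearMap.adjoint (QkW L m n φ U hL αU hα1 hU1 hreg (c₀ := c₀) (c₁ := c₁)) ∘ₗ
            ((a : ℂ) • QkW L m n φ U hL αU hα1 hU1 hreg (c₀ := c₀) (c₁ := c₁))) y) =
      tpair φ τ y ((laplaceAkPi L m n φ τ η U a' hpos' hL αU hα1 hU1 hreg (c₁ := c₁) a
        - LinearMap.adjoint (QkW L m n φ U hL αU hα1 hU1 hreg (c₀ := c₀) (c₁ := c₁)) ∘ₗ
            ((a : ℂ) • QkW L m n φ U hL αU hα1 hU1 hreg (c₀ := c₀) (c₁ := c₁))) x) := by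
  rw [laplaceAkPi_sub_QaQ_apply, laplaceAkPi_sub_QaQ_apply, tpair_add_right, tpair_add_right,
    ← deltaPiOfUk_GpOfUk_eq_adjoint_form L m n φ τ η hUlev hU hφ hτ₁ hτ₂ a' hpos',
    tpair_deltaPiOfUk_comm L m n φ τ η U _ hτ₂ hφ hU x y, tpair_DRD_comm L m n φ τ η hUlev hU hφ hτ₁ hτ₂ x y]

/-! ## §3 The binder `hsym` of the re-typed Proposition 4 at the letters -/

variable [FiniteDimensional ℂ 𝔸] {Lr : ℝ} [Fact (0 < Lr)] [Fact (0 < η)]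
  {lev₀ : Bond d (towerP L m (n + 1)) → ℕ} {κ' : Type*} [Fintype κ'] (lev₁ : κ' → ℕ) (Dc : (Bond d (towerP L m (n + 1)) → 𝔸) →ₗ[ℂ] (κ' → 𝔸))

include hUlev hU hφ hτ₁ hτ₂ in
/-- **THE BINDER `hsym` OF `B11Eq98W80Composite.quadAnalytic_W80_composite` FOR `Δπ := currentCLM φ lev₁ Dc (Δ̃_{a,k} − Q_k†∘(aQ_k))`** (print's `Δ_π + DRD*`
of (87)–(88) read as a current-valued map on the space (115), the trace as a continuous functional): `Σ_b τ((Δπ Y₁)(b)·Y₂(b)) = Σ_b τ((Δπ Y₂)(b)·Y₁(b))` —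
unitary tower, `⋆`-tracial `τ`, the cell's norming; the `η^d` of `pairSum_currentCLM_comm` cancelled.
[cite: Balaban1985Variational, (27) p.282, (80) p.290, (87)–(88) p.291; Balaban1985BackgroundPropagators, (3.119) p.419, (3.122) p.420] -/
theorem pairSum_current_laplaceAkPi_sub_QaQ_comm (a : ℝ) (Y₁ Y₂ : Space115 Lr η lev₀ lev₁ Dc) :
    ∑ b' : Bond d (towerP L m (n + 1)), LinearMap.toContinuousLinearMap τ
        (NegSup.equiv (levWeight Lr η lev₀ 3) 𝔸 (currentCLM φ lev₁ Dc
          (laplaceAkPi L m n φ τ η U a' hpos' hL αU hα1 hU1 hreg (c₁ := c₁) a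
            - LinearMap.adjoint (QkW L m n φ U hL αU hα1 hU1 hreg (c₀ := c₀) (c₁ := c₁)) ∘ₗ
                ((a : ℂ) • QkW L m n φ U hL αU hα1 hU1 hreg (c₀ := c₀) (c₁ := c₁))) Y₁) b' * flat115 Y₂ b') =
      ∑ b' : Bond d (towerP L m (n + 1)), LinearMap.toContinuousLinearMap τ
        (NegSup.equiv (levWeight Lr η lev₀ 3) 𝔸 (currentCLM φ lev₁ Dc
          (laplaceAkPi L m n φ τ η U a' hpos' hL αU hα1 hU1 hreg (c₁ := c₁) a
            - LinearMap.adjoint (QkW L m n φ U hL αU hα1 hU1 hreg (c₀ := c₀) (c₁ := c₁)) ∘ₗ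
                ((a : ℂ) • QkW L m n φ U hL αU hα1 hU1 hreg (c₀ := c₀) (c₁ := c₁))) Y₂) b' * flat115 Y₁ b') := by
  have hη : ((η : ℂ)) ^ d ≠ 0 := pow_ne_zero _ (by exact_mod_cast (Fact.out : (0 : ℝ) < η).ne')
  have h := pairSum_currentCLM_comm φ τ lev₁ Dc hτ₂ (L := Lr) (η := η) (lev₀ := lev₀)
    (tpair_laplaceAkPi_sub_QaQ_comm L m n φ τ η hUlev hU hφ hτ₁ hτ₂ a' hpos' hL αU hα1 hU1 hreg a) Y₁ Y₂
  simp only [LinearMap.coe_toContinuousLinearMap']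
  exact mul_left_cancel₀ hη h

end Tower

end Literature.MathematicalPhysics.QuantumFieldTheory.Balaban1983to89.B11Eq88LaplaceH1CurrentSymmetry

end
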